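import Literature.NumberTheory.EllipticCurves.DivisionPointsLaneCoherence
import HarnessLib

/-!
# CM DESCENT of `E₁`-membership for readings on the lane curve: `ξ(u′) ∈ E₁ ⟹ ξ(αu′) ∈ E₁`, and `2`-power torsion readings
# `ξ(u′)` with `αu′ ∉ Λ` are NOT in `E₁` (de Shalit II.4.4 (iv) / II.4.9 (ii) — the lane inputs of (N1); proofs only)

Topic `NumberTheory/EllipticCurves` (theorems only; no definition, no named fact, no instance).  Cell `bsd-print-cf2`, width seat
`bsd-line-cf2-p1-w5` g17, piece B9 (N1)-lane.  `Cm7Kernel.mem_kernel_of_cmDescent` (`Cm7KernelDescent`) reduces the bridge hypothesis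
`hU : U m ∈ E₁` to three lane statements about READINGS `ι_vξ(z)` of division points on the lane curve
`curveOver M′ ((W ⊗ ℤ_p) ⊗ LTCoeff F)`: the DESCENT `k•Y(n+1) + R ∈ E₁ → k•Y n + R ∈ E₁`, and the exclusions `Y 0 + R ∉ E₁`, `R ∉ E₁`.
All three are instances of the two theorems of this file, whose data are EXACTLY those of
`DivisionPointsLaneCoherence.ltSMul_zPt_eq_inclPt_zPt_of_readings` (B10f-a: the lane `e, π, P, W`, `V̂ = F_P`, `p = ϖπ`; the readings
`ι_ℂ, ι_v` of `K♭`; the theta presentation `ψ, j`, `T_R`, base points `ξ(Ω₁)`, `ξ(αΩ₁)`, the transformation pair and its re-centred lifts,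
`hidX`/`hidY`) at ONE level `M′`, with the order hypothesis REPLACED by `αu′ ∉ Λ` and the exclusion `αu′ + 2αΩ₁ ∉ Λ`:

* ★★★ `some_mem_kernel_of_readings_of_mem_kernel` — **`ξ(u′) ∈ E₁(M′) ⟹ ξ(αu′) ∈ E₁(M′)`** (both read in `M′`).  Non-degenerate branch
  (`[π]_{P′} z(U′) ≠ 0`): `CMFormalActionLaneCoherence.ptOfZ_ltSMul_eq_sub_of_cm_identities` gives `P([π] z(U′)) = ξ(α(Ω₁+u′)) − ξ(αΩ₁)`,
  which is `ξ(αu′)` by `some_sub_some_eq_some_curveOver_of_readings`, and `P(·) ∈ E₁` (`ptOfZ_mem_kernel`).  Degenerate branch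
  (`[π] z(U′) = 0`): `CMFormalActionNilIdealPointsChart.eq_cK_of_cm_identity_of_coe_evalPt₁_eq_zero` gives `x(ξ(α(Ω₁+u′))) = x(ξ(αΩ₁))`,
  so `α(Ω₁+u′) ≡ ±αΩ₁` (`weierstrassP_eq_weierstrassP_iff`), i.e. `αu′ ∈ Λ` or `αu′ + 2αΩ₁ ∈ Λ` — both excluded.
* ★★ `not_mem_kernel_some_of_readings_of_nsmul_eq_zero` — **a reading `ξ(u′)` with `p • ξ(u′) = O`, `αu′ ∉ Λ`, `αu′ + 2αΩ₁ ∉ Λ` is NOT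
  in `E₁(M′)`**: in `E₁`, `p • U′ = O` forces `[π]_{P′} z(U′) = 0` (`pow_nsmul_eq_zero_iff_ltSMul_hom_one_zPt`, `p = ϖπ`), the degenerate
  branch above.
With `α = ψ(𝔭) = π₀`: the descent hypothesis of `Cm7Kernel.mem_kernel_of_cmDescent` is the first theorem at `u′ = k·u_{n+2} + ū`
(`αu′ ≡ k·u_{n+1} + ū`), and its `h₀`, `hRk` are the second at `u′ = u₁ + ū`, `u′ = ū` (`2u′ ∈ Λ`, `αu′ ≡ ū ∉ Λ`; the exclusion holds
because `ū`, `u₁` are `2`-power torsion while `Ω₁` is a primitive `𝔣`-point, `(𝔣, 2) = 1`).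

No summit statement is proved; BSD is not proved by any of this.

## References
* [deShalit1987] E. de Shalit, *Iwasawa theory of elliptic curves with complex multiplication* (1987), II §1.10, II §4.4 (iv), II §4.9 (ii).
* [SilvermanAEC2009] J. H. Silverman, *The Arithmetic of Elliptic Curves*, 2nd ed. (2009), III.2.3, VI.3.6 (b), VII.2.2.
-/

noncomputable section

open scoped Classical PeriodPair
open Polynomial

namespace Literature.NumberTheory.EllipticCurves

open ValuativeRel Literature.NumberTheory.GaloisRepresentations
  Literature.NumberTheory.GaloisRepresentations.IsNonarchimedeanLocalField
  Literature.NumberTheory.GaloisRepresentations.LubinTate Field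
open Literature.NumberTheory.EllipticCurves.FormalGroupChart _root_.WeierstrassCurve _root_.PeriodPair

section Descent

variable {F : Type} [Field F] [ValuativeRel F] [TopologicalSpace F] [IsNonarchimedeanLocalField F]

attribute [local instance] ltNormUniformSpace ltNormIsUniformAddGroup rk1 nF nE fintypeResidueField

variable {p : ℕ} [Fact p.Prime] (e : 𝒪[F] ≃+* ℤ_[p]) (hq : residueFieldCard F = p)
  {π : 𝒪[F]} (hπ : (valuation F).IsUniformizer (π : F)) {πZ : ℤ_[p]} (he : e π = πZ)
  (hA : IsLTRing πZ p) {P : PowerSeries ℤ_[p]} (hP : IsLTSeries πZ p P) (W : WeierstrassCurve ℤ)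
  (hV : (W.map (Int.castRingHom ℤ_[p])).formalGroupLaw = ltF hA hP) {ϖ : ℤ_[p]} (hp : (p : ℤ_[p]) = ϖ * πZ) (hϖ : IsUnit ϖ)
  (M' : IntermediateField F (AlgebraicClosure F)) [FiniteDimensional F M']
  [hEll' : (curveOver M' ((W.map (Int.castRingHom ℤ_[p])).map ((LTCoeff.of F).toRingHom.comp e.symm.toRingHom))).IsElliptic]
  {Kb : Type*} [Field Kb] (ιc : Kb →+* ℂ) (ιv : Kb →+* AlgebraicClosure F)
  {R : Type*} [CommRing R] (ψ : R →+* unitBall M') (j : R →+* Kb)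
  (hψj : ∀ r : R, ((((ψ r : unitBall M') : M') : AlgebraicClosure F)) = ιv (j r))
  (L : PeriodPair) (h₂ : L.g₂ = (W.baseChange ℂ).c₄ / 12) (h₃ : L.g₃ = (W.baseChange ℂ).c₆ / 216)

include hq he hψj h₂ h₃ in
set_option maxHeartbeats 1600000 in
/-- **The degenerate branch is impossible**: for a reading `U′ = ξ(u′) ∈ E₁(M′)` with `[π]_{P′} z(U′) = 0` (value `0`), the `x`-identity
at `ξ(Ω₁ + u′)` forces `x(ξ(α(Ω₁+u′))) = x(ξ(αΩ₁))` (`eq_cK_of_cm_identity_of_coe_evalPt₁_eq_zero` on the `R`-presentation), hence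
`αu′ ∈ Λ` or `αu′ + 2αΩ₁ ∈ Λ`. [cite: deShalit1987, II §4.4 (iv), II §4.9 (ii)] [cite: SilvermanAEC2009, VII.2.2] -/
theorem false_of_readings_of_coe_ltSMul_zPt_eq_zero
    {αR : R} {PC QC : ℂ[X]}
    (hT : ∀ z : ℂ, z ∉ L.lattice → ιc (j αR) * z ∉ L.lattice → PC.eval (℘[L] z) = ℘[L] (ιc (j αR) * z) * QC.eval (℘[L] z))
    {Pr Qr : R[X]} {s : ℂ} (hs : s ≠ 0)
    (hQr : Qr.map (ιc.comp j) = C s * QC.comp (X + C ((W.baseChange ℂ).b₂ / 12)))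
    (hPr : Pr.map (ιc.comp j) = C s * (PC.comp (X + C ((W.baseChange ℂ).b₂ / 12)) -
      C ((W.baseChange ℂ).b₂ / 12) * QC.comp (X + C ((W.baseChange ℂ).b₂ / 12))))
    {T : PowerSeries R} (hT0 : PowerSeries.constantCoeff T = 0)
    (hTP : T.map ψ = (P.map ((LTCoeff.of F).toRingHom.comp e.symm.toRingHom)).map (algebraMap (LTCoeff F) (unitBall M')))
    {x₀ y₀ x₁ y₁ : R}
    (hidX : (((W.map (Int.castRingHom R)).translateX x₁ y₁).subst T + PowerSeries.C (0 : R)) *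
        Polynomial.aeval ((W.map (Int.castRingHom R)).translateX x₀ y₀ + PowerSeries.C (0 : R)) Qr =
      Polynomial.aeval ((W.map (Int.castRingHom R)).translateX x₀ y₀ + PowerSeries.C (0 : R)) Pr)
    -- the arguments and their readings
    {Ω₁ u' : ℂ} (hΩ₁ : Ω₁ ∉ L.lattice) (hαΩ₁ : ιc (j αR) * Ω₁ ∉ L.lattice) (hu' : u' ∉ L.lattice)
    (hw : Ω₁ + u' ∉ L.lattice) (hαw : ιc (j αR) * (Ω₁ + u') ∉ L.lattice)
    (hαu' : ιc (j αR) * u' ∉ L.lattice) (hexcl : ιc (j αR) * u' + 2 * (ιc (j αR) * Ω₁) ∉ L.lattice)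
    (hQ : QC.eval (℘[L] (Ω₁ + u')) ≠ 0)
    (hx₀ : ιc (j x₀) = ℘[L] Ω₁ - (W.baseChange ℂ).b₂ / 12)
    (hy₀ : ιc (j y₀) = (℘'[L] Ω₁ - (W.baseChange ℂ).a₁ * (℘[L] Ω₁ - (W.baseChange ℂ).b₂ / 12) - (W.baseChange ℂ).a₃) / 2)
    (hx₁ : ιc (j x₁) = ℘[L] (ιc (j αR) * Ω₁) - (W.baseChange ℂ).b₂ / 12)
    {xu' yu' xw yw xz yz : Kb}
    (hxu' : ιc xu' = ℘[L] u' - (W.baseChange ℂ).b₂ / 12)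
    (hyu' : ιc yu' = (℘'[L] u' - (W.baseChange ℂ).a₁ * (℘[L] u' - (W.baseChange ℂ).b₂ / 12) - (W.baseChange ℂ).a₃) / 2)
    (hxw : ιc xw = ℘[L] (Ω₁ + u') - (W.baseChange ℂ).b₂ / 12)
    (hyw : ιc yw = (℘'[L] (Ω₁ + u') - (W.baseChange ℂ).a₁ * (℘[L] (Ω₁ + u') - (W.baseChange ℂ).b₂ / 12) - (W.baseChange ℂ).a₃) / 2)
    (hxz : ιc xz = ℘[L] (ιc (j αR) * (Ω₁ + u')) - (W.baseChange ℂ).b₂ / 12)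
    (hyz : ιc yz = (℘'[L] (ιc (j αR) * (Ω₁ + u')) - (W.baseChange ℂ).a₁ * (℘[L] (ιc (j αR) * (Ω₁ + u')) - (W.baseChange ℂ).b₂ / 12) -
      (W.baseChange ℂ).a₃) / 2)
    {XU' YU' XW YW XZ YZ : M'} (hXU' : ((XU' : M') : AlgebraicClosure F) = ιv xu') (hYU' : ((YU' : M') : AlgebraicClosure F) = ιv yu')
    (hXW : ((XW : M') : AlgebraicClosure F) = ιv xw) (hYW : ((YW : M') : AlgebraicClosure F) = ιv yw)
    (hXZ : ((XZ : M') : AlgebraicClosure F) = ιv xz) (hYZ : ((YZ : M') : AlgebraicClosure F) = ιv yz)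
    {hnU' : (curveOver M' ((W.map (Int.castRingHom ℤ_[p])).map ((LTCoeff.of F).toRingHom.comp e.symm.toRingHom))).toAffine.Nonsingular XU' YU'}
    (hU' : (.some XU' YU' hnU' : (curveOver M' ((W.map (Int.castRingHom ℤ_[p])).map
        ((LTCoeff.of F).toRingHom.comp e.symm.toRingHom))).toAffine.Point) ∈
      kernel (NormedField.valuation (K := M')) (curveOver M' ((W.map (Int.castRingHom ℤ_[p])).map ((LTCoeff.of F).toRingHom.comp e.symm.toRingHom))))
    (hs0 : (((ltSMul (maxNilIdeal F M') (isLTRing_LTCoeff hπ) (isLTSeries_map_LTCoeff_of_degree_one e hq he hP) (LTCoeff.of F π)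
        (zPt (.some XU' YU' hnU') hU') : (maxNilIdeal F M').toIdeal) : unitBall M') : M') = 0) : False := by
  -- the two presentations share one integral model
  have hWR : (W.map (Int.castRingHom R)).map ψ =
      ((W.map (Int.castRingHom ℤ_[p])).map ((LTCoeff.of F).toRingHom.comp e.symm.toRingHom)).map
        (algebraMap (LTCoeff F) (unitBall M')) := by
    rw [WeierstrassCurve.map_map (W.map (Int.castRingHom ℤ_[p]))]
    exact WeierstrassCurve.map_intCast_eq_map_intCast W _ _
  -- nonsingularity of the points involved and `P₁ + U′ = ξ(Ω₁ + u′)`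
  have h₀ := nonsingular_curveOver_of_readings e M' W ιc ιv L h₂ h₃ hΩ₁ hx₀ hy₀ (X := ((ψ x₀ : unitBall M') : M'))
    (Y := ((ψ y₀ : unitBall M') : M')) (hψj x₀) (hψj y₀)
  have hnW := nonsingular_curveOver_of_readings e M' W ιc ιv L h₂ h₃ hw hxw hyw hXW hYW
  have hsub : (.some XW YW hnW : (curveOver M' ((W.map (Int.castRingHom ℤ_[p])).map
      ((LTCoeff.of F).toRingHom.comp e.symm.toRingHom))).toAffine.Point) - .some XU' YU' hnU' = .some _ _ h₀ :=
    some_sub_some_eq_some_curveOver_of_readings e M' W ιc ιv L h₂ h₃ hΩ₁ hu' hw rfl hx₀ hy₀ hxu' hyu' hxw hyw (hψj x₀) (hψj y₀)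
      hXU' hYU' hXW hYW h₀ hnU' hnW
  have hsum : (.some _ _ h₀ : (curveOver M' ((W.map (Int.castRingHom ℤ_[p])).map
      ((LTCoeff.of F).toRingHom.comp e.symm.toRingHom))).toAffine.Point) + .some XU' YU' hnU' = .some XW YW hnW :=
    (sub_eq_iff_eq_add.mp hsub).symm
  -- the `x`-identity in `M′` and `Q̂(X_W) ≠ 0`
  obtain ⟨hZx, -⟩ := cmChart_of_readings M' ιc ιv ψ j hψj W L hT hQr hPr hw hαw hxw hyw hxz hyz hXW hYW hXZ hYZ
  have hQM := eval₂_ne_zero_of_readings M' ιc ιv ψ j hψj W L hs hQr hQ hxw hXW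
  -- `R` as a discrete coefficient ring acting on `𝒪_{M′}` through `ψ` (as in `ptOfZ_ltSMul_eq_sub_of_cm_identities`)
  letI : UniformSpace R := ⊥
  haveI : DiscreteUniformity R := ⟨rfl⟩
  letI : Algebra R (unitBall M') := ψ.toAlgebra
  have halg : algebraMap R (unitBall M') = ψ := rfl
  haveI : ContinuousSMul R (unitBall M') := by
    refine ⟨continuous_prod_of_discrete_left.mpr fun a => ?_⟩
    change Continuous fun s : unitBall M' => ψ a * s
    exact continuous_const_mul _
  have hpres : ((W.map (Int.castRingHom ℤ_[p])).map ((LTCoeff.of F).toRingHom.comp e.symm.toRingHom)).map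
      (algebraMap (LTCoeff F) (unitBall M')) = (W.map (Int.castRingHom R)).map (algebraMap R (unitBall M')) := by rw [halg, hWR]
  have hC := curveOver_eq_of_map_algebraMap_eq (K := M') hpres
  haveI : (curveOver M' (W.map (Int.castRingHom R))).IsElliptic := hC ▸ hEll'
  -- the parameter `t = z(U′)`, `U′ = P(t)`, `t ≠ 0`, and `T_R(t) = [π]_{P′} t = 0`
  set t : (ballNilIdeal M').toIdeal := zPt (.some XU' YU' hnU') hU' with ht
  have hUeq : (.some XU' YU' hnU' : (curveOver M' ((W.map (Int.castRingHom ℤ_[p])).map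
      ((LTCoeff.of F).toRingHom.comp e.symm.toRingHom))).toAffine.Point) =
      ptOfZ M' ((W.map (Int.castRingHom ℤ_[p])).map ((LTCoeff.of F).toRingHom.comp e.symm.toRingHom)) t := eq_ptOfZ_zPt hU'
  have ht0 : ((t : unitBall M') : M') ≠ 0 := by
    intro h0
    have : ptOfZ M' ((W.map (Int.castRingHom ℤ_[p])).map ((LTCoeff.of F).toRingHom.comp e.symm.toRingHom)) t = 0 :=
      ptOfZ_of_eq_zero h0
    rw [this] at hUeq
    exact Affine.Point.some_ne_zero _ hUeq
  have e1 : (ltSMul (maxNilIdeal F M') (isLTRing_LTCoeff hπ) (isLTSeries_map_LTCoeff_of_degree_one e hq he hP) (LTCoeff.of F π) t :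
      (maxNilIdeal F M').toIdeal) = evalPt₁ (ballNilIdeal M') T hT0 t := by
    apply Subtype.ext
    change ((evalPt₁ (maxNilIdeal F M') (hom (isLTRing_LTCoeff hπ) (isLTSeries_map_LTCoeff_of_degree_one e hq he hP)
      (isLTSeries_map_LTCoeff_of_degree_one e hq he hP) (LTCoeff.of F π))
      (constantCoeff_hom (isLTRing_LTCoeff hπ) (isLTSeries_map_LTCoeff_of_degree_one e hq he hP)
        (isLTSeries_map_LTCoeff_of_degree_one e hq he hP) (LTCoeff.of F π)) t :
      (maxNilIdeal F M').toIdeal) : unitBall M') = _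
    rw [coe_evalPt₁_eq_evS_map, coe_evalPt₁_eq_evS_map, hom_self_eq (isLTRing_LTCoeff hπ) (isLTSeries_map_LTCoeff_of_degree_one e hq he hP),
      halg, hTP]
    rfl
  have hTt0 : (((evalPt₁ (ballNilIdeal M') T hT0 t : (ballNilIdeal M').toIdeal) : unitBall M') : M') = 0 := by
    rw [← e1]; exact hs0
  -- transport `P₁ + P(t) = ξ(Ω₁ + u′)` to the `R`-curve and apply the degenerate lemma: `X_Z = x(ξ(αΩ₁))`
  have h₀R : (curveOver M' (W.map (Int.castRingHom R))).toAffine.Nonsingular (cK M' x₀) (cK M' y₀) := hC ▸ h₀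
  have hSR : (curveOver M' (W.map (Int.castRingHom R))).toAffine.Nonsingular XW YW := hC ▸ hnW
  rw [hUeq] at hsum
  have hsumR : (.some _ _ h₀R : (curveOver M' (W.map (Int.castRingHom R))).toAffine.Point) + ptOfZ M' (W.map (Int.castRingHom R)) t =
      .some XW YW hSR :=
    (some_add_ptOfZ_eq_some_iff_of_map_algebraMap_eq (K := M') hpres ht0).mp hsum
  have hxZ : XZ = cK M' x₁ := by
    refine eq_cK_of_cm_identity_of_coe_evalPt₁_eq_zero (K := M') (W := W.map (Int.castRingHom R)) hT0 hidX h₀R ht0 hTt0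
      (hS := hSR) ?_ hQM hZx
    convert hsumR using 4; rfl
  -- read `X_Z = x(ξ(αΩ₁))` in `ℂ`: `℘(α(Ω₁ + u′)) = ℘(αΩ₁)`
  have h1 : ιv xz = ιv (j x₁) := by
    rw [← hXZ, ← hψj x₁, hxZ]; rfl
  have h2 := ιv.injective h1
  have h3 : ℘[L] (ιc (j αR) * (Ω₁ + u')) = ℘[L] (ιc (j αR) * Ω₁) := by
    have := congrArg ιc h2
    rw [hxz, hx₁] at this
    exact sub_left_injective this
  rcases (L.weierstrassP_eq_weierstrassP_iff hαw hαΩ₁).mp h3 with h4 | h4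
  · exact hexcl (by convert h4 using 1; ring)
  · exact hαu' (by convert h4 using 1; ring)

include hq hπ he hV hp hϖ hψj h₂ h₃ in
set_option maxHeartbeats 1600000 in
/-- ★★ **A `p`-torsion reading with `αu′ ∉ Λ` is not in `E₁`**: for `U′ = ξ(u′)` read in `M′` with `p • U′ = O`, `αu′ ∉ Λ` and
`αu′ + 2αΩ₁ ∉ Λ` (plus the theta presentation data of `ltSMul_zPt_eq_inclPt_zPt_of_readings` and the readings of `ξ(Ω₁ + u′)`,
`ξ(α(Ω₁ + u′))`), `U′ ∉ E₁(M′)`: in `E₁`, `p • U′ = O` forces `[π]_{P′} z(U′) = 0` (`p = ϖπ`), the impossible degenerate branch.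
In the lane (`α = π₀`, `p = 2`): `R = ξ(ū) ∉ E₁` and `ξ(u₁ + ū) ∉ E₁` — the hypotheses `hRk`, `h₀` of `Cm7Kernel.mem_kernel_of_cmDescent`.
[cite: deShalit1987, II §4.4 (iv), II §4.9 (ii)] [cite: SilvermanAEC2009, VII.2.2] -/
theorem not_mem_kernel_some_of_readings_of_nsmul_eq_zero
    {αR : R} {PC QC : ℂ[X]}
    (hT : ∀ z : ℂ, z ∉ L.lattice → ιc (j αR) * z ∉ L.lattice → PC.eval (℘[L] z) = ℘[L] (ιc (j αR) * z) * QC.eval (℘[L] z))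
    {Pr Qr : R[X]} {s : ℂ} (hs : s ≠ 0)
    (hQr : Qr.map (ιc.comp j) = C s * QC.comp (X + C ((W.baseChange ℂ).b₂ / 12)))
    (hPr : Pr.map (ιc.comp j) = C s * (PC.comp (X + C ((W.baseChange ℂ).b₂ / 12)) -
      C ((W.baseChange ℂ).b₂ / 12) * QC.comp (X + C ((W.baseChange ℂ).b₂ / 12))))
    {T : PowerSeries R} (hT0 : PowerSeries.constantCoeff T = 0)
    (hTP : T.map ψ = (P.map ((LTCoeff.of F).toRingHom.comp e.symm.toRingHom)).map (algebraMap (LTCoeff F) (unitBall M')))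
    {x₀ y₀ x₁ y₁ : R}
    (hidX : (((W.map (Int.castRingHom R)).translateX x₁ y₁).subst T + PowerSeries.C (0 : R)) *
        Polynomial.aeval ((W.map (Int.castRingHom R)).translateX x₀ y₀ + PowerSeries.C (0 : R)) Qr =
      Polynomial.aeval ((W.map (Int.castRingHom R)).translateX x₀ y₀ + PowerSeries.C (0 : R)) Pr)
    {Ω₁ u' : ℂ} (hΩ₁ : Ω₁ ∉ L.lattice) (hαΩ₁ : ιc (j αR) * Ω₁ ∉ L.lattice) (hu' : u' ∉ L.lattice)
    (hw : Ω₁ + u' ∉ L.lattice) (hαw : ιc (j αR) * (Ω₁ + u') ∉ L.lattice)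
    (hαu' : ιc (j αR) * u' ∉ L.lattice) (hexcl : ιc (j αR) * u' + 2 * (ιc (j αR) * Ω₁) ∉ L.lattice)
    (hQ : QC.eval (℘[L] (Ω₁ + u')) ≠ 0)
    (hx₀ : ιc (j x₀) = ℘[L] Ω₁ - (W.baseChange ℂ).b₂ / 12)
    (hy₀ : ιc (j y₀) = (℘'[L] Ω₁ - (W.baseChange ℂ).a₁ * (℘[L] Ω₁ - (W.baseChange ℂ).b₂ / 12) - (W.baseChange ℂ).a₃) / 2)
    (hx₁ : ιc (j x₁) = ℘[L] (ιc (j αR) * Ω₁) - (W.baseChange ℂ).b₂ / 12)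
    {xu' yu' xw yw xz yz : Kb}
    (hxu' : ιc xu' = ℘[L] u' - (W.baseChange ℂ).b₂ / 12)
    (hyu' : ιc yu' = (℘'[L] u' - (W.baseChange ℂ).a₁ * (℘[L] u' - (W.baseChange ℂ).b₂ / 12) - (W.baseChange ℂ).a₃) / 2)
    (hxw : ιc xw = ℘[L] (Ω₁ + u') - (W.baseChange ℂ).b₂ / 12)
    (hyw : ιc yw = (℘'[L] (Ω₁ + u') - (W.baseChange ℂ).a₁ * (℘[L] (Ω₁ + u') - (W.baseChange ℂ).b₂ / 12) - (W.baseChange ℂ).a₃) / 2)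
    (hxz : ιc xz = ℘[L] (ιc (j αR) * (Ω₁ + u')) - (W.baseChange ℂ).b₂ / 12)
    (hyz : ιc yz = (℘'[L] (ιc (j αR) * (Ω₁ + u')) - (W.baseChange ℂ).a₁ * (℘[L] (ιc (j αR) * (Ω₁ + u')) - (W.baseChange ℂ).b₂ / 12) -
      (W.baseChange ℂ).a₃) / 2)
    {XU' YU' XW YW XZ YZ : M'} (hXU' : ((XU' : M') : AlgebraicClosure F) = ιv xu') (hYU' : ((YU' : M') : AlgebraicClosure F) = ιv yu')
    (hXW : ((XW : M') : AlgebraicClosure F) = ιv xw) (hYW : ((YW : M') : AlgebraicClosure F) = ιv yw)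
    (hXZ : ((XZ : M') : AlgebraicClosure F) = ιv xz) (hYZ : ((YZ : M') : AlgebraicClosure F) = ιv yz)
    {hnU' : (curveOver M' ((W.map (Int.castRingHom ℤ_[p])).map ((LTCoeff.of F).toRingHom.comp e.symm.toRingHom))).toAffine.Nonsingular XU' YU'}
    (hpU : p • (.some XU' YU' hnU' : (curveOver M' ((W.map (Int.castRingHom ℤ_[p])).map
        ((LTCoeff.of F).toRingHom.comp e.symm.toRingHom))).toAffine.Point) = 0) :
    (.some XU' YU' hnU' : (curveOver M' ((W.map (Int.castRingHom ℤ_[p])).map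
        ((LTCoeff.of F).toRingHom.comp e.symm.toRingHom))).toAffine.Point) ∉
      kernel (NormedField.valuation (K := M')) (curveOver M' ((W.map (Int.castRingHom ℤ_[p])).map
        ((LTCoeff.of F).toRingHom.comp e.symm.toRingHom))) := by
  intro hU'
  -- in `E₁`, `p • U′ = O` forces `[π]_{P′} z(U′) = 0`
  have hVF := formalGroupLaw_map_eq_ltF_of_degree_one e hq hπ he hA hP (W.map (Int.castRingHom ℤ_[p])) hV
  have h1 := (pow_nsmul_eq_zero_iff_ltSMul_hom_one_zPt (K := M') (isLTRing_LTCoeff hπ)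
    (isLTSeries_map_LTCoeff_of_degree_one e hq he hP) (isLTSeries_map_LTCoeff_of_degree_one e hq he hP) hVF
    (natCast_eq_mul_of_degree_one e he hp) (isUnit_map_of_degree_one e hϖ) 1 hU').mp (by rw [pow_one]; exact hpU)
  rw [ltSMul_evalPt₁_hom_one_eq_zero_iff, pow_one] at h1
  have hz : ltSMul (maxNilIdeal F M') (isLTRing_LTCoeff hπ) (isLTSeries_map_LTCoeff_of_degree_one e hq he hP) (LTCoeff.of F π)
      (zPt (.some XU' YU' hnU') hU') = 0 := h1
  have hs0 : (((ltSMul (maxNilIdeal F M') (isLTRing_LTCoeff hπ) (isLTSeries_map_LTCoeff_of_degree_one e hq he hP) (LTCoeff.of F π)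
      (zPt (.some XU' YU' hnU') hU') : (maxNilIdeal F M').toIdeal) : unitBall M') : M') = 0 := by
    rw [hz]; rfl
  exact false_of_readings_of_coe_ltSMul_zPt_eq_zero e hq hπ he hP W M' ιc ιv ψ j hψj L h₂ h₃ hT hs hQr hPr hT0 hTP hidX hΩ₁ hαΩ₁
    hu' hw hαw hαu' hexcl hQ hx₀ hy₀ hx₁ hxu' hyu' hxw hyw hxz hyz hXU' hYU' hXW hYW hXZ hYZ hU' hs0

include hq hπ he hP hψj h₂ h₃ in
set_option maxHeartbeats 1600000 in
/-- ★★★ **CM descent of `E₁`-membership for readings: `ξ(u′) ∈ E₁(M′) ⟹ ξ(αu′) ∈ E₁(M′)`.**  Data: those of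
`ltSMul_zPt_eq_inclPt_zPt_of_readings` at the single level `M′` (lane, readings, theta presentation, `T_R`, base points, transformation
pair, `hidX`/`hidY`), the reading `U′ = ξ(u′) ∈ E₁(M′)`, the readings of `ξ(Ω₁ + u′)`, `ξ(α(Ω₁ + u′))` and of `ξ(αu′)` (`αu′ ∉ Λ`), the
exclusion `αu′ + 2αΩ₁ ∉ Λ`, `Q(℘(Ω₁ + u′)) ≠ 0`, `s ≠ 0`, `2 ≠ 0`.  Conclusion: the reading of `ξ(αu′)` lies in `E₁(M′)`.
Non-degenerate branch: `P([π]_{P′} z(U′)) = ξ(α(Ω₁+u′)) − ξ(αΩ₁) = ξ(αu′)` and `P(·) ∈ E₁`; degenerate branch: impossible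
(`false_of_readings_of_coe_ltSMul_zPt_eq_zero`).  In the lane (`α = π₀`): with `u′ = k·u_{n+2} + ū` (`αu′ ≡ k·u_{n+1} + ū`) this is the
descent hypothesis `hdesc` of `Cm7Kernel.mem_kernel_of_cmDescent`. [cite: deShalit1987, II §4.4 (iv), II §4.9 Proposition (ii)]
[cite: SilvermanAEC2009, III.2.3, VII.2.2] -/
theorem some_mem_kernel_of_readings_of_mem_kernel
    {αR : R} {PC QC : ℂ[X]}
    (hT : ∀ z : ℂ, z ∉ L.lattice → ιc (j αR) * z ∉ L.lattice → PC.eval (℘[L] z) = ℘[L] (ιc (j αR) * z) * QC.eval (℘[L] z))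
    {Pr Qr : R[X]} {s : ℂ} (hs : s ≠ 0)
    (hQr : Qr.map (ιc.comp j) = C s * QC.comp (X + C ((W.baseChange ℂ).b₂ / 12)))
    (hPr : Pr.map (ιc.comp j) = C s * (PC.comp (X + C ((W.baseChange ℂ).b₂ / 12)) -
      C ((W.baseChange ℂ).b₂ / 12) * QC.comp (X + C ((W.baseChange ℂ).b₂ / 12))))
    {T : PowerSeries R} (hT0 : PowerSeries.constantCoeff T = 0)
    (hTP : T.map ψ = (P.map ((LTCoeff.of F).toRingHom.comp e.symm.toRingHom)).map (algebraMap (LTCoeff F) (unitBall M')))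
    {x₀ y₀ x₁ y₁ : R}
    (hidX : (((W.map (Int.castRingHom R)).translateX x₁ y₁).subst T + PowerSeries.C (0 : R)) *
        Polynomial.aeval ((W.map (Int.castRingHom R)).translateX x₀ y₀ + PowerSeries.C (0 : R)) Qr =
      Polynomial.aeval ((W.map (Int.castRingHom R)).translateX x₀ y₀ + PowerSeries.C (0 : R)) Pr)
    (hidY : PowerSeries.C αR * (2 * PowerSeries.subst T ((W.map (Int.castRingHom R)).translateY x₁ y₁) +
            PowerSeries.C (W.map (Int.castRingHom R)).a₁ * PowerSeries.subst T ((W.map (Int.castRingHom R)).translateX x₁ y₁) +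
            PowerSeries.C (W.map (Int.castRingHom R)).a₃) *
          Polynomial.aeval ((W.map (Int.castRingHom R)).translateX x₀ y₀ + PowerSeries.C (0 : R)) Qr +
        (PowerSeries.subst T ((W.map (Int.castRingHom R)).translateX x₁ y₁) + PowerSeries.C (0 : R)) *
          Polynomial.aeval ((W.map (Int.castRingHom R)).translateX x₀ y₀ + PowerSeries.C (0 : R)) (Polynomial.derivative Qr) *
          (2 * (W.map (Int.castRingHom R)).translateY x₀ y₀ +
            PowerSeries.C (W.map (Int.castRingHom R)).a₁ * (W.map (Int.castRingHom R)).translateX x₀ y₀ +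
            PowerSeries.C (W.map (Int.castRingHom R)).a₃) =
      Polynomial.aeval ((W.map (Int.castRingHom R)).translateX x₀ y₀ + PowerSeries.C (0 : R)) (Polynomial.derivative Pr) *
        (2 * (W.map (Int.castRingHom R)).translateY x₀ y₀ +
          PowerSeries.C (W.map (Int.castRingHom R)).a₁ * (W.map (Int.castRingHom R)).translateX x₀ y₀ +
          PowerSeries.C (W.map (Int.castRingHom R)).a₃))
    -- the arguments and their readings
    {Ω₁ u' : ℂ} (hΩ₁ : Ω₁ ∉ L.lattice) (hαΩ₁ : ιc (j αR) * Ω₁ ∉ L.lattice) (hu' : u' ∉ L.lattice)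
    (hw : Ω₁ + u' ∉ L.lattice) (hαw : ιc (j αR) * (Ω₁ + u') ∉ L.lattice)
    (hαu' : ιc (j αR) * u' ∉ L.lattice) (hexcl : ιc (j αR) * u' + 2 * (ιc (j αR) * Ω₁) ∉ L.lattice)
    (hQ : QC.eval (℘[L] (Ω₁ + u')) ≠ 0)
    (hx₀ : ιc (j x₀) = ℘[L] Ω₁ - (W.baseChange ℂ).b₂ / 12)
    (hy₀ : ιc (j y₀) = (℘'[L] Ω₁ - (W.baseChange ℂ).a₁ * (℘[L] Ω₁ - (W.baseChange ℂ).b₂ / 12) - (W.baseChange ℂ).a₃) / 2)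
    (hx₁ : ιc (j x₁) = ℘[L] (ιc (j αR) * Ω₁) - (W.baseChange ℂ).b₂ / 12)
    (hy₁ : ιc (j y₁) = (℘'[L] (ιc (j αR) * Ω₁) - (W.baseChange ℂ).a₁ * (℘[L] (ιc (j αR) * Ω₁) - (W.baseChange ℂ).b₂ / 12) -
      (W.baseChange ℂ).a₃) / 2)
    {xu' yu' xw yw xz yz xq yq : Kb}
    (hxu' : ιc xu' = ℘[L] u' - (W.baseChange ℂ).b₂ / 12)
    (hyu' : ιc yu' = (℘'[L] u' - (W.baseChange ℂ).a₁ * (℘[L] u' - (W.baseChange ℂ).b₂ / 12) - (W.baseChange ℂ).a₃) / 2)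
    (hxw : ιc xw = ℘[L] (Ω₁ + u') - (W.baseChange ℂ).b₂ / 12)
    (hyw : ιc yw = (℘'[L] (Ω₁ + u') - (W.baseChange ℂ).a₁ * (℘[L] (Ω₁ + u') - (W.baseChange ℂ).b₂ / 12) - (W.baseChange ℂ).a₃) / 2)
    (hxz : ιc xz = ℘[L] (ιc (j αR) * (Ω₁ + u')) - (W.baseChange ℂ).b₂ / 12)
    (hyz : ιc yz = (℘'[L] (ιc (j αR) * (Ω₁ + u')) - (W.baseChange ℂ).a₁ * (℘[L] (ιc (j αR) * (Ω₁ + u')) - (W.baseChange ℂ).b₂ / 12) -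
      (W.baseChange ℂ).a₃) / 2)
    (hxq : ιc xq = ℘[L] (ιc (j αR) * u') - (W.baseChange ℂ).b₂ / 12)
    (hyq : ιc yq = (℘'[L] (ιc (j αR) * u') - (W.baseChange ℂ).a₁ * (℘[L] (ιc (j αR) * u') - (W.baseChange ℂ).b₂ / 12) -
      (W.baseChange ℂ).a₃) / 2)
    {XU' YU' XW YW XZ YZ XQ YQ : M'} (hXU' : ((XU' : M') : AlgebraicClosure F) = ιv xu') (hYU' : ((YU' : M') : AlgebraicClosure F) = ιv yu')
    (hXW : ((XW : M') : AlgebraicClosure F) = ιv xw) (hYW : ((YW : M') : AlgebraicClosure F) = ιv yw)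
    (hXZ : ((XZ : M') : AlgebraicClosure F) = ιv xz) (hYZ : ((YZ : M') : AlgebraicClosure F) = ιv yz)
    (hXQ : ((XQ : M') : AlgebraicClosure F) = ιv xq) (hYQ : ((YQ : M') : AlgebraicClosure F) = ιv yq)
    {hnU' : (curveOver M' ((W.map (Int.castRingHom ℤ_[p])).map ((LTCoeff.of F).toRingHom.comp e.symm.toRingHom))).toAffine.Nonsingular XU' YU'}
    {hnQ : (curveOver M' ((W.map (Int.castRingHom ℤ_[p])).map ((LTCoeff.of F).toRingHom.comp e.symm.toRingHom))).toAffine.Nonsingular XQ YQ}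
    (hU' : (.some XU' YU' hnU' : (curveOver M' ((W.map (Int.castRingHom ℤ_[p])).map
        ((LTCoeff.of F).toRingHom.comp e.symm.toRingHom))).toAffine.Point) ∈
      kernel (NormedField.valuation (K := M')) (curveOver M' ((W.map (Int.castRingHom ℤ_[p])).map ((LTCoeff.of F).toRingHom.comp e.symm.toRingHom))))
    (h2 : (2 : M') ≠ 0) :
    (.some XQ YQ hnQ : (curveOver M' ((W.map (Int.castRingHom ℤ_[p])).map
        ((LTCoeff.of F).toRingHom.comp e.symm.toRingHom))).toAffine.Point) ∈
      kernel (NormedField.valuation (K := M')) (curveOver M' ((W.map (Int.castRingHom ℤ_[p])).map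
        ((LTCoeff.of F).toRingHom.comp e.symm.toRingHom))) := by
  by_cases hs0 : (((ltSMul (maxNilIdeal F M') (isLTRing_LTCoeff hπ) (isLTSeries_map_LTCoeff_of_degree_one e hq he hP) (LTCoeff.of F π)
      (zPt (.some XU' YU' hnU') hU') : (maxNilIdeal F M').toIdeal) : unitBall M') : M') = 0
  · exact (false_of_readings_of_coe_ltSMul_zPt_eq_zero e hq hπ he hP W M' ιc ιv ψ j hψj L h₂ h₃ hT hs hQr hPr hT0 hTP hidX hΩ₁ hαΩ₁
      hu' hw hαw hαu' hexcl hQ hx₀ hy₀ hx₁ hxu' hyu' hxw hyw hxz hyz hXU' hYU' hXW hYW hXZ hYZ hU' hs0).elim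
  -- non-degenerate branch: `P([π] z(U′)) = ξ(α(Ω₁ + u′)) − ξ(αΩ₁)` (B10d), `= ξ(αu′)` (B10c), and `P(·) ∈ E₁`
  have hWR : (W.map (Int.castRingHom R)).map ψ =
      ((W.map (Int.castRingHom ℤ_[p])).map ((LTCoeff.of F).toRingHom.comp e.symm.toRingHom)).map
        (algebraMap (LTCoeff F) (unitBall M')) := by
    rw [WeierstrassCurve.map_map (W.map (Int.castRingHom ℤ_[p]))]
    exact WeierstrassCurve.map_intCast_eq_map_intCast W _ _
  have hα0 : ιc (j αR) ≠ 0 := fun h => hαΩ₁ (by rw [h, zero_mul]; exact zero_mem _)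
  have h₀ := nonsingular_curveOver_of_readings e M' W ιc ιv L h₂ h₃ hΩ₁ hx₀ hy₀ (X := ((ψ x₀ : unitBall M') : M'))
    (Y := ((ψ y₀ : unitBall M') : M')) (hψj x₀) (hψj y₀)
  have h₁ := nonsingular_curveOver_of_readings e M' W ιc ιv L h₂ h₃ hαΩ₁ hx₁ hy₁ (X := ((ψ x₁ : unitBall M') : M'))
    (Y := ((ψ y₁ : unitBall M') : M')) (hψj x₁) (hψj y₁)
  have hnW := nonsingular_curveOver_of_readings e M' W ιc ιv L h₂ h₃ hw hxw hyw hXW hYW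
  have hnZ := nonsingular_curveOver_of_readings e M' W ιc ιv L h₂ h₃ hαw hxz hyz hXZ hYZ
  have hsub : (.some XW YW hnW : (curveOver M' ((W.map (Int.castRingHom ℤ_[p])).map
      ((LTCoeff.of F).toRingHom.comp e.symm.toRingHom))).toAffine.Point) - .some XU' YU' hnU' = .some _ _ h₀ :=
    some_sub_some_eq_some_curveOver_of_readings e M' W ιc ιv L h₂ h₃ hΩ₁ hu' hw rfl hx₀ hy₀ hxu' hyu' hxw hyw (hψj x₀) (hψj y₀)
      hXU' hYU' hXW hYW h₀ hnU' hnW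
  have hsum : (.some _ _ h₀ : (curveOver M' ((W.map (Int.castRingHom ℤ_[p])).map
      ((LTCoeff.of F).toRingHom.comp e.symm.toRingHom))).toAffine.Point) + .some XU' YU' hnU' = .some XW YW hnW :=
    (sub_eq_iff_eq_add.mp hsub).symm
  obtain ⟨hZx, hZy⟩ := cmChart_of_readings M' ιc ιv ψ j hψj W L hT hQr hPr hw hαw hxw hyw hxz hyz hXW hYW hXZ hYZ
  have hQM := eval₂_ne_zero_of_readings M' ιc ιv ψ j hψj W L hs hQr hQ hxw hXW
  have hα : ((ψ αR : unitBall M') : M') ≠ 0 := by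
    intro h0
    have h1 := congrArg (algebraMap M' (AlgebraicClosure F)) h0
    rw [map_zero, show algebraMap M' (AlgebraicClosure F) ((ψ αR : unitBall M') : M') = ιv (j αR) from hψj αR,
      map_eq_zero_iff ιv ιv.injective] at h1
    exact hα0 (by rw [h1, map_zero])
  have key := ptOfZ_ltSMul_eq_sub_of_cm_identities M' (isLTRing_LTCoeff hπ) (isLTSeries_map_LTCoeff_of_degree_one e hq he hP)
    ((W.map (Int.castRingHom ℤ_[p])).map ((LTCoeff.of F).toRingHom.comp e.symm.toRingHom)) ψ (W.map (Int.castRingHom R)) hWR hT0 hTP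
    hidX hidY hU' h₀ h₁ hsum hnZ hQM hα h2 hZx hZy hs0
  have hsub2 : (.some XZ YZ hnZ : (curveOver M' ((W.map (Int.castRingHom ℤ_[p])).map
      ((LTCoeff.of F).toRingHom.comp e.symm.toRingHom))).toAffine.Point) - .some _ _ h₁ = .some XQ YQ hnQ :=
    some_sub_some_eq_some_curveOver_of_readings e M' W ιc ιv L h₂ h₃ hαu' hαΩ₁ hαw (by ring) hxq hyq hx₁ hy₁ hxz hyz hXQ hYQ
      (hψj x₁) (hψj y₁) hXZ hYZ hnQ h₁ hnZ
  rw [hsub2] at key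
  rw [← key]
  exact ptOfZ_mem_kernel _

end Descent

end Literature.NumberTheory.EllipticCurves

end
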